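import Literature.Computability.AlgebraicComplexity.KV20NonRigidEquations
import Literature.RingTheory.Nullstellensatz.PerronTheorem
import Literature.NumberTheory.DiophantineGeometry.PlaneCurveSections
import HarnessLib

/-!
# Kumar–Volk 2020/2022, §2–§3 and Theorem 1.1 — PROOFS of the typed facts
# `kumarVolk2020_lem_2_1`, `kumarVolk2020_lem_3_1`, `kumarVolk2020_lem_3_2`, `kumarVolk2020_thm_1_1`

Topic: `Literature/Computability/AlgebraicComplexity`. Source: M. Kumar, B. L. Volk, *A polynomial
degree bound on equations for non-rigid matrices and small linear circuits*, ACM TOCT 14(2) (2022)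
art. 6 = arXiv:2003.12938 [KumarVolk2022] (journal numbering, as in the statement file
`KV20NonRigidEquations.lean`). This file is theorem-only: it discharges the four named facts of the
statement file by the printed proofs.

## The printed proofs and their renderings

* **Lemma 2.1** (dimension count, [s2 p0009]): "Let `V₁` denote the subspace of polynomials over
  `F` in `N` variables of degree at most `Δ`. Let `V₂` denote the subspace of polynomials over `F`
  in `K` variables of degree at most `DΔ`. Consider the linear transformation `T : V₁ → V₂` given by
  `Q ↦ Q ∘ P` … `dim V₁ = binom(N+Δ, N) > binom(K+DΔ, K) = dim V₂` by assumption. This implies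
  that `T` has a non-trivial kernel". Rendered verbatim with Mathlib's `restrictTotalDegree`
  (`V₁`, `V₂`), `MvPolynomial.aeval P` (`Q ↦ Q ∘ P`; degree bound
  `Literature.RingTheory.Nullstellensatz.totalDegree_aeval_le`), the monomial-basis count
  `Literature.NumberTheory.DiophantineGeometry.PlaneCurve.finrank_restrictTotalDegree_eq_choose` and
  `LinearMap.ker_ne_bot_of_finrank_lt`: `KumarVolk2020.exists_isEquationFor_polyMapImage` (any
  finite index types), whence `kumarVolk2020_lem_2_1_holds`.
* **Lemma 3.1** ([SV15] map, [s2 p0011]): "pick distinct `α_1, …, α_n ∈ F`, and let `u_1, …, u_n`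
  be their corresponding Lagrange's interpolation polynomials … `u_i(z) = ∏_{j ≠ i} (z − α_j) /
  ∏_{j ≠ i} (α_i − α_j)`. Let `P_i(x, y) = ∑_{j=1}^k u_i(y_j) · x_j` … we can set `y_j = α_{i_j}`".
  Rendered verbatim (`KumarVolk2020.lagrangeIndicator`, `KumarVolk2020.svMap`, evaluation lemmas
  `eval_svMap_of_not_mem_range` / `eval_svMap_apply`), for an arbitrary finite index type of
  coordinates with an injective node assignment `a : ι ↪ F`; only `|ι|` nodes are used, so the
  printed `|F| > n` is relaxed to `|F| ≥ n` (`KumarVolk2020.exists_svMap`), whence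
  `kumarVolk2020_lem_3_1_holds`.
* **Lemma 3.2** ([s2 p0011–p0012]): "`P(u, v, x, y) = UV(u, v) + SV_{n²,s}(x, y)` … Decompose
  `R = U₀ V₀` … we may assume `|T| = s` (otherwise, pad with zeros arbitrarily). Let `α` denote the
  setting for `y` in `SV_{n²,s}` that maps `x_1, …, x_s` to `T`". Rendered verbatim over the
  structured variable type `((Fin n × Fin r) ⊕ (Fin r × Fin n)) ⊕ (Fin s ⊕ Fin s)` and transported to
  the fact's `Fin (2rn + 2s)` by `MvPolynomial.rename` along an equivalence; the rank factorisation
  `R = U₀ V₀` is `KumarVolk2020.exists_mul_eq_of_rank_le` (a basis of the column space, padded with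
  zero columns); the padding of the support is `Finset.exists_superset_card_eq`. The degree-`2` term
  `UV` needs `n ≥ 2` for "degree at most `n²`"; the corners `n ≤ 1` (where the printed bound `n²`
  is `≤ 1`) are settled directly (`KumarVolk2020.lem_3_2_small`). Whence
  `kumarVolk2020_lem_3_2_holds`.
* **Theorem 1.1** ([s2 p0012]): "We apply Lemma 2.1 with the map `P` from Lemma 3.2 …
  `N = n²`, `D = n²` and `K = 4εn²` … `Δ = n³`". The printed estimate `binom(n²+n³, n²) ≥ n^{n²}`,
  `binom(4εn²+n⁵, 4εn²) ≤ (2n⁵)^{4εn²}` "smaller than `n^{n²}` for every large enough `n`" is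
  replaced by the exact elementary chain (valid for EVERY `n ≥ 1`, so the fact's `n₀` is `1`):
  `binom(K+n⁵, K) ≤ (n⁵+1)^K ≤ (n+1)^{5K} < (n+1)^{n²} ≤ binom(n²+n³, n²)`, using
  `5K = 10rn + 10s ≤ 20εn² < n²` for `ε < 1/25` (`KumarVolk2020.choose_add_le_succ_pow`,
  `KumarVolk2020.succ_pow_le_choose`). Whence `kumarVolk2020_thm_1_1_holds`.

Honest framing (val-lit): these are discharges of published, proved statements; nothing here bears
on `VP ≠ VNP`.

## References

* [KumarVolk2022] M. Kumar, B. L. Volk, ACM TOCT 14(2) (2022) art. 6, doi:10.1145/3543685,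
  arXiv:2003.12938 — Lemma 2.1, Lemmas 3.1–3.2, Theorem 1.1.
* [SV15] A. Shpilka, I. Volkovich, Comput. Complexity 24 (2015) — the map of Lemma 3.1.
-/

noncomputable section

open MvPolynomial Module
open Literature.NumberTheory.DiophantineGeometry.PlaneCurve (finrank_restrictTotalDegree_eq_choose)

namespace Literature.Computability.AlgebraicComplexity

namespace KumarVolk2020

/-! ### Lemma 2.1: the dimension count -/

section DimensionCount

variable {F : Type*} [Field F] {κ ι : Type*}

/-- Evaluating `Q ∘ P` at `β` is evaluating `Q` at `P(β)`. [cite: KumarVolk2022, Lemma 2.1 (proof)] -/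
theorem eval_aeval_eq (P : ι → MvPolynomial κ F) (Q : MvPolynomial ι F) (β : κ → F) :
    eval β (aeval P Q) = eval (fun i => eval β (P i)) Q := by
  rw [← coe_aeval_eq_eval, ← coe_aeval_eq_eval]
  change (aeval β) (bind₁ P Q) = _
  rw [aeval_bind₁]
  rfl

variable [Fintype κ] [Fintype ι]

/-- **Kumar–Volk, Lemma 2.1 (dimension count), for arbitrary finite index types.** If every
coordinate `P_i` (`i ∈ ι`) of a polynomial map in the variables `κ` has degree `≤ D` and
`binom(|κ| + DΔ, |κ|) < binom(|ι| + Δ, |ι|)`, then some nonzero `Q` of degree `≤ Δ` vanishes on the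
image of `P`: the composition `Q ↦ Q ∘ P` maps `F[y_ι]_{≤ Δ}` (dimension `binom(|ι|+Δ, |ι|)`) linearly
into `F[x_κ]_{≤ DΔ}` (dimension `binom(|κ|+DΔ, |κ|)`), so it has a kernel.
[cite: KumarVolk2022, Lemma 2.1] -/
theorem exists_isEquationFor_polyMapImage (P : ι → MvPolynomial κ F) {D Δ : ℕ}
    (hP : ∀ i, (P i).totalDegree ≤ D)
    (hlt : (Fintype.card κ + D * Δ).choose (Fintype.card κ) <
      (Fintype.card ι + Δ).choose (Fintype.card ι)) :
    ∃ Q : MvPolynomial ι F, IsEquationFor (polyMapImage P) Q ∧ Q.totalDegree ≤ Δ := by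
  classical
  set V₁ := restrictTotalDegree ι F Δ with hV₁
  set V₂ := restrictTotalDegree κ F (D * Δ) with hV₂
  have hmap : ∀ Q : MvPolynomial ι F, Q ∈ V₁ → aeval P Q ∈ V₂ := by
    intro Q hQ
    rw [hV₂, mem_restrictTotalDegree]
    rw [hV₁, mem_restrictTotalDegree] at hQ
    calc (aeval P Q).totalDegree ≤ Q.totalDegree * D :=
          Literature.RingTheory.Nullstellensatz.totalDegree_aeval_le P hP Q
      _ ≤ Δ * D := Nat.mul_le_mul_right _ hQ
      _ = D * Δ := Nat.mul_comm _ _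
  let T : V₁ →ₗ[F] V₂ :=
    LinearMap.codRestrict V₂ ((aeval P).toLinearMap.comp V₁.subtype) fun Q => hmap Q.1 Q.2
  have hfin : finrank F V₂ < finrank F V₁ := by
    rw [hV₁, hV₂, finrank_restrictTotalDegree_eq_choose, finrank_restrictTotalDegree_eq_choose,
      Nat.add_comm (D * Δ), Nat.add_comm Δ]
    exact hlt
  have hker : LinearMap.ker T ≠ ⊥ := LinearMap.ker_ne_bot_of_finrank_lt hfin
  obtain ⟨Q, hQker, hQ0⟩ := (Submodule.ne_bot_iff _).1 hker
  have hQP : aeval P Q.1 = 0 := by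
    have := congrArg Subtype.val (LinearMap.mem_ker.1 hQker)
    simpa [T] using this
  refine ⟨Q.1, ⟨fun h => hQ0 (Subtype.ext h), fun x hx => ?_⟩, ?_⟩
  · obtain ⟨β, rfl⟩ := hx
    rw [← eval_aeval_eq, hQP, map_zero]
  · exact (mem_restrictTotalDegree _ _ _).1 Q.2

end DimensionCount

/-! ### Lemma 3.1: the Shpilka–Volkovich map -/

section SVMap

variable {F : Type*} [Field F] {ι : Type*} [Fintype ι] [DecidableEq ι]

/-- The Lagrange indicator `u_i(z) = ∏_{i' ≠ i} (z − α_{i'}) / (α_i − α_{i'})` of the node `α_i`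
among the distinct nodes `α : ι ↪ F`, as a polynomial in the variable `z = X v`.
[cite: KumarVolk2022, Lemma 3.1 (proof)] -/
def lagrangeIndicator {τ : Type*} (a : ι ↪ F) (i : ι) (v : τ) : MvPolynomial τ F :=
  ∏ i' ∈ Finset.univ.erase i, (C (a i - a i')⁻¹ * (X v - C (a i')))

omit [Fintype ι] [DecidableEq ι] in
/-- Each Lagrange factor `c · (z − b)` has degree `≤ 1`. [cite: KumarVolk2022, Lemma 3.1 (proof)] -/
private theorem totalDegree_factor_le {τ : Type*} (c b : F) (v : τ) :
    (C c * (X v - C b) : MvPolynomial τ F).totalDegree ≤ 1 := by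
  calc (C c * (X v - C b) : MvPolynomial τ F).totalDegree
      ≤ (C c : MvPolynomial τ F).totalDegree + (X v - C b : MvPolynomial τ F).totalDegree :=
        totalDegree_mul _ _
    _ ≤ 0 + 1 := by
        refine Nat.add_le_add (totalDegree_C c).le ?_
        refine (totalDegree_sub _ _).trans (max_le (totalDegree_X v).le ?_)
        rw [totalDegree_C]; exact Nat.zero_le _
    _ = 1 := rfl

/-- `deg u_i ≤ |ι| − 1` ("polynomials of degree at most `n − 1`"). [cite: KumarVolk2022, Lemma 3.1 (proof)] -/
theorem totalDegree_lagrangeIndicator_le {τ : Type*} (a : ι ↪ F) (i : ι) (v : τ) :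
    (lagrangeIndicator a i v).totalDegree ≤ Fintype.card ι - 1 := by
  unfold lagrangeIndicator
  refine (totalDegree_finsetProd _ _).trans ?_
  calc ∑ i' ∈ Finset.univ.erase i, (C (a i - a i')⁻¹ * (X v - C (a i')) : MvPolynomial τ F).totalDegree
      ≤ ∑ _i' ∈ Finset.univ.erase i, 1 := Finset.sum_le_sum fun i' _ => totalDegree_factor_le _ _ _
    _ = Fintype.card ι - 1 := by
        rw [Finset.sum_const, smul_eq_mul, mul_one, Finset.card_erase_of_mem (Finset.mem_univ _),
          Finset.card_univ]

/-- **`u_i(α_j) = [i = j]`**: at an assignment sending the variable `v` to the node `α_j`, the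
indicator `u_i` evaluates to `1` if `i = j` and to `0` otherwise. [cite: KumarVolk2022, Lemma 3.1 (proof)] -/
theorem eval_lagrangeIndicator {τ : Type*} (a : ι ↪ F) (i j : ι) (v : τ) (g : τ → F)
    (hg : g v = a j) : eval g (lagrangeIndicator a i v) = if i = j then 1 else 0 := by
  unfold lagrangeIndicator
  rw [eval_prod]
  simp only [map_mul, eval_C, map_sub, eval_X, hg]
  split_ifs with hij
  · subst hij
    refine Finset.prod_eq_one fun i' hi' => ?_
    have hne : a i - a i' ≠ 0 := sub_ne_zero.2 fun h => (Finset.mem_erase.1 hi').1 (a.injective h).symm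
    exact inv_mul_cancel₀ hne
  · refine Finset.prod_eq_zero (Finset.mem_erase.2 ⟨fun h => hij h.symm, Finset.mem_univ j⟩) ?_
    rw [sub_self, mul_zero]

/-- **The map `SV_{ι,k}`**: `P_i(x, y) = ∑_{j=1}^k u_i(y_j) · x_j` (variables `x = inl`, `y = inr`).
[cite: KumarVolk2022, Lemma 3.1 (proof)] -/
def svMap (a : ι ↪ F) (k : ℕ) (i : ι) : MvPolynomial (Fin k ⊕ Fin k) F :=
  ∑ j : Fin k, lagrangeIndicator a i (Sum.inr j) * X (Sum.inl j)

/-- "The upper bound on the degree follows by inspection": `deg P_i ≤ (|ι| − 1) + 1 ≤ |ι|`.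
[cite: KumarVolk2022, Lemma 3.1] -/
theorem totalDegree_svMap_le (a : ι ↪ F) (k : ℕ) (i : ι) :
    (svMap a k i).totalDegree ≤ Fintype.card ι := by
  have hcard : 1 ≤ Fintype.card ι := Fintype.card_pos_iff.2 ⟨i⟩
  unfold svMap
  refine totalDegree_finsetSum_le fun j _ => ?_
  calc (lagrangeIndicator a i (Sum.inr j) * X (Sum.inl j) : MvPolynomial (Fin k ⊕ Fin k) F).totalDegree
      ≤ (lagrangeIndicator a i (Sum.inr j) : MvPolynomial (Fin k ⊕ Fin k) F).totalDegree +
          (X (Sum.inl j) : MvPolynomial (Fin k ⊕ Fin k) F).totalDegree := totalDegree_mul _ _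
    _ ≤ (Fintype.card ι - 1) + 1 :=
        Nat.add_le_add (totalDegree_lagrangeIndicator_le a i _) (totalDegree_X _).le
    _ = Fintype.card ι := Nat.sub_add_cancel hcard

/-- Evaluation of `SV` at `y_j = α_{T j}`: `P_i(x, α_T) = ∑_j [i = T j] · x_j`.
[cite: KumarVolk2022, Lemma 3.1 (proof)] -/
theorem eval_svMap (a : ι ↪ F) {k : ℕ} (T : Fin k → ι) (x : Fin k → F) (i : ι) :
    eval (Sum.elim x fun j => a (T j)) (svMap a k i) = ∑ j, if i = T j then x j else 0 := by
  unfold svMap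
  rw [eval_sum]
  refine Finset.sum_congr rfl fun j _ => ?_
  rw [eval_mul, eval_X, eval_lagrangeIndicator a i (T j) (Sum.inr j) _ (by simp)]
  simp

/-- Off the selected coordinates `SV(x, α_T)` vanishes identically. [cite: KumarVolk2022, Lemma 3.1] -/
theorem eval_svMap_of_not_mem_range (a : ι ↪ F) {k : ℕ} (T : Fin k → ι) (x : Fin k → F) {i : ι}
    (hi : i ∉ Set.range T) : eval (Sum.elim x fun j => a (T j)) (svMap a k i) = 0 := by
  rw [eval_svMap]
  refine Finset.sum_eq_zero fun j _ => ?_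
  rw [if_neg]
  exact fun h => hi ⟨j, h.symm⟩

/-- On the selected coordinate `i_j = T j` (with `T` injective) `SV(x, α_T)` equals `x_j`.
[cite: KumarVolk2022, Lemma 3.1] -/
theorem eval_svMap_apply (a : ι ↪ F) {k : ℕ} (T : Fin k ↪ ι) (x : Fin k → F) (j : Fin k) :
    eval (Sum.elim x fun j => a (T j)) (svMap a k (T j)) = x j := by
  rw [eval_svMap]
  have : ∀ j', (if T j = T j' then x j' else 0) = if j = j' then x j' else 0 := fun j' => by
    simp only [T.injective.eq_iff]
  simp_rw [this]
  rw [Finset.sum_ite_eq]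
  simp

/-- **Kumar–Volk, Lemma 3.1 with `|ι|` nodes**: for distinct nodes `α : ι ↪ F` and every `k`
there is a polynomial map `SV : F^{2k} → F^ι` of degree `≤ |ι|` which, for every `k`-subset
`T = {i_1, …, i_k}` (an embedding `Fin k ↪ ι`), under `y = α_T` vanishes identically off `T` and
equals `x_j` on `i_j`. [cite: KumarVolk2022, Lemma 3.1] -/
theorem exists_svMap (a : ι ↪ F) (k : ℕ) :
    ∃ SV : ι → MvPolynomial (Fin k ⊕ Fin k) F,
      (∀ i, (SV i).totalDegree ≤ Fintype.card ι) ∧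
      ∀ T : Fin k ↪ ι, ∃ α : Fin k → F, ∀ x : Fin k → F,
        (∀ i : ι, i ∉ Set.range T → eval (Sum.elim x α) (SV i) = 0) ∧
        ∀ j : Fin k, eval (Sum.elim x α) (SV (T j)) = x j :=
  ⟨svMap a k, totalDegree_svMap_le a k, fun T => ⟨fun j => a (T j), fun x =>
    ⟨fun _ hi => eval_svMap_of_not_mem_range a T x hi, fun j => eval_svMap_apply a T x j⟩⟩⟩

end SVMap

/-! ### Lemma 3.2: rank factorisation and the map `UV + SV_{n²,s}` -/

section RankFactor

variable {F : Type*} [Field F] {μ ν : Type*} [Fintype ν] [DecidableEq ν]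

/-- "Decompose `R = U₀ V₀` for `n × r` matrix `U₀` and `r × n` matrix `V₀`": a matrix of rank `≤ r`
over a field factors through `F^r` (columns of `U₀` = a basis of the column space of `R`, padded
with zero columns; `V₀` = the coordinates of the columns of `R`). [cite: KumarVolk2022, Lemma 3.2 (proof)] -/
theorem exists_mul_eq_of_rank_le (M : Matrix μ ν F) {r : ℕ} (hr : M.rank ≤ r) :
    ∃ (A : Matrix μ (Fin r) F) (B : Matrix (Fin r) ν F), A * B = M := by
  classical
  let S : Submodule F (μ → F) := LinearMap.range M.mulVecLin
  let b : Basis (Fin M.rank) F S := Module.finBasisOfFinrankEq F S rfl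
  have hcol : ∀ j : ν, (fun i => M i j) ∈ S := fun j =>
    ⟨Pi.single j 1, by rw [Matrix.mulVecLin_apply, Matrix.mulVec_single_one]; rfl⟩
  let c : ν → S := fun j => ⟨fun i => M i j, hcol j⟩
  let A' : Matrix μ (Fin M.rank) F := fun i t => (b t : μ → F) i
  let B' : Matrix (Fin M.rank) ν F := fun t j => b.repr (c j) t
  have hcore : A' * B' = M := by
    ext i j
    have h := congrArg (fun v : S => (v : μ → F) i) (b.sum_repr (c j))
    simp only [Submodule.coe_sum, Submodule.coe_smul, Finset.sum_apply, Pi.smul_apply,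
      smul_eq_mul] at h
    rw [Matrix.mul_apply]
    simpa only [A', B', mul_comm] using h
  let ι' : Fin M.rank → Fin r := Fin.castLE hr
  have hι' : Function.Injective ι' := Fin.castLE_injective hr
  let E : Matrix (Fin M.rank) (Fin r) F := (1 : Matrix (Fin r) (Fin r) F).submatrix ι' id
  let D : Matrix (Fin r) (Fin M.rank) F := (1 : Matrix (Fin r) (Fin r) F).submatrix id ι'
  have hED : E * D = 1 := by
    have h := Matrix.submatrix_mul (1 : Matrix (Fin r) (Fin r) F) (1 : Matrix (Fin r) (Fin r) F)
      ι' (id : Fin r → Fin r) ι' Function.bijective_id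
    rw [Matrix.mul_one, Matrix.submatrix_one ι' hι'] at h
    exact h.symm
  refine ⟨A' * E, D * B', ?_⟩
  calc A' * E * (D * B') = A' * (E * D) * B' := by simp only [Matrix.mul_assoc]
    _ = M := by rw [hED, Matrix.mul_one, hcore]

/-- In particular a matrix of rank `≤ 0` is zero. [cite: KumarVolk2022, Lemma 3.2 (proof)] -/
theorem eq_zero_of_rank_le_zero (M : Matrix μ ν F) (hr : M.rank ≤ 0) : M = 0 := by
  obtain ⟨A, B, hAB⟩ := exists_mul_eq_of_rank_le M hr
  rw [← hAB]
  ext i j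
  simp [Matrix.mul_apply]

end RankFactor

section PolyMapTransport

variable {F : Type*} [CommSemiring F] {κ κ' ι : Type*}

/-- Renaming the variables of a polynomial map along an equivalence does not change its image.
[cite: KumarVolk2022, §2.2] -/
theorem polyMapImage_rename_equiv (e : κ ≃ κ') (Q : ι → MvPolynomial κ F) :
    polyMapImage (fun i => rename e (Q i)) = polyMapImage Q := by
  ext x
  simp only [mem_polyMapImage_iff, eval_rename]
  constructor
  · rintro ⟨β, rfl⟩
    exact ⟨β ∘ e, rfl⟩
  · rintro ⟨β, rfl⟩
    refine ⟨β ∘ e.symm, ?_⟩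
    funext i
    simp [Function.comp_assoc]

end PolyMapTransport

section Lemma32

variable {F : Type*} [Field F]

/-- The degree-`2` map `UV(u, v)` ("`U` a symbolic `n × r` matrix …, `V` a symbolic `r × n` matrix
… the matrix multiplication `UV`"), entry `(i, j)`, over the variables
`((u : Fin n × Fin r) ⊕ (v : Fin r × Fin n)) ⊕ ((x : Fin s) ⊕ (y : Fin s))`.
[cite: KumarVolk2022, Lemma 3.2 (proof)] -/
def uvMap (n r s : ℕ) (p : Fin n × Fin n) :
    MvPolynomial (((Fin n × Fin r) ⊕ (Fin r × Fin n)) ⊕ (Fin s ⊕ Fin s)) F :=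
  ∑ t : Fin r, X (Sum.inl (Sum.inl (p.1, t))) * X (Sum.inl (Sum.inr (t, p.2)))

/-- The map `P(u, v, x, y) = UV(u, v) + SV_{n²,s}(x, y)` of Lemma 3.2 (nodes `α : [n]×[n] ↪ F`),
entry `p = (i, j)`. [cite: KumarVolk2022, Lemma 3.2 (proof)] -/
def kvMap {n : ℕ} (a : (Fin n × Fin n) ↪ F) (r s : ℕ) (p : Fin n × Fin n) :
    MvPolynomial (((Fin n × Fin r) ⊕ (Fin r × Fin n)) ⊕ (Fin s ⊕ Fin s)) F :=
  uvMap n r s p + rename Sum.inr (svMap a s p)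

/-- `deg UV ≤ 2`, and `UV = 0` when `r = 0`. [cite: KumarVolk2022, Lemma 3.2 (proof)] -/
theorem totalDegree_uvMap_le (n r s : ℕ) (p : Fin n × Fin n) :
    (uvMap (F := F) n r s p).totalDegree ≤ if r = 0 then 0 else 2 := by
  unfold uvMap
  split_ifs with hr
  · subst hr
    simp
  · refine totalDegree_finsetSum_le fun t _ => (totalDegree_mul _ _).trans ?_
    exact Nat.add_le_add (totalDegree_X _).le (totalDegree_X _).le

/-- "of degree at most `n²`" — valid when `r = 0` or `n ≥ 2` (the term `UV` has degree `2`).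
[cite: KumarVolk2022, Lemma 3.2] -/
theorem totalDegree_kvMap_le {n : ℕ} (a : (Fin n × Fin n) ↪ F) (r s : ℕ) (p : Fin n × Fin n)
    (h : r = 0 ∨ 2 ≤ n) : (kvMap a r s p).totalDegree ≤ n ^ 2 := by
  unfold kvMap
  refine (totalDegree_add _ _).trans (max_le ?_ ?_)
  · refine (totalDegree_uvMap_le n r s p).trans ?_
    rcases h with h | h
    · simp [h]
    · split_ifs
      · exact Nat.zero_le _
      · nlinarith
  · refine (totalDegree_rename_le _ _).trans ((totalDegree_svMap_le a s p).trans ?_)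
    rw [Fintype.card_prod, Fintype.card_fin, sq]

/-- `UV(u, v)` evaluates to the product of the matrices read off `u` and `v`.
[cite: KumarVolk2022, Lemma 3.2 (proof)] -/
theorem eval_uvMap (n r s : ℕ) (p : Fin n × Fin n)
    (β : ((Fin n × Fin r) ⊕ (Fin r × Fin n)) ⊕ (Fin s ⊕ Fin s) → F) :
    eval β (uvMap n r s p) =
      ((Matrix.of fun i t => β (Sum.inl (Sum.inl (i, t)))) *
        (Matrix.of fun t j => β (Sum.inl (Sum.inr (t, j))))) p.1 p.2 := by
  unfold uvMap
  rw [eval_sum, Matrix.mul_apply]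
  simp

/-- **"every matrix `M` that is not `(r, s)` rigid lies in its image"** (the printed assignment:
`u, v ↦ U₀, V₀` with `R = U₀V₀`; `y ↦ α_T` for the padded support `T`, `|T| = s`; `x ↦` the
entries of `S` on `T`). [cite: KumarVolk2022, Lemma 3.2] -/
theorem nonRigidSet_subset_polyMapImage_kvMap {n : ℕ} (a : (Fin n × Fin n) ↪ F) {r s : ℕ}
    (hs : s ≤ n ^ 2) : nonRigidSet F n r s ⊆ polyMapImage (kvMap a r s) := by
  classical
  intro x hx
  obtain ⟨R, S, hR, ⟨T, hT, hS⟩, hx⟩ := (mem_nonRigidSet_iff x).1 hx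
  -- `R = U₀ V₀`
  obtain ⟨A, B, hAB⟩ := exists_mul_eq_of_rank_le R hR
  -- pad the support to size exactly `s` and enumerate it
  obtain ⟨T', hTT', hT'⟩ := Finset.exists_superset_card_eq hT
    (by rw [Fintype.card_prod, Fintype.card_fin, ← sq]; exact hs)
  let π : Fin s → Fin n × Fin n := fun t => (T'.equivFin.symm (Fin.cast hT'.symm t) : Fin n × Fin n)
  have hπinj : Function.Injective π := fun t t' h => by
    have := Subtype.ext h
    simpa [π] using this
  have hπT : ∀ p ∈ T, p ∈ Set.range π := fun p hp =>
    ⟨Fin.cast hT' (T'.equivFin ⟨p, hTT' hp⟩), by simp [π]⟩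
  let πe : Fin s ↪ Fin n × Fin n := ⟨π, hπinj⟩
  -- the assignment
  let xv : Fin s → F := fun t => S (π t).1 (π t).2
  let β : ((Fin n × Fin r) ⊕ (Fin r × Fin n)) ⊕ (Fin s ⊕ Fin s) → F :=
    Sum.elim (Sum.elim (fun q => A q.1 q.2) (fun q => B q.1 q.2)) (Sum.elim xv fun t => a (π t))
  refine ⟨β, funext fun p => ?_⟩
  have hSV : eval (β ∘ Sum.inr) (svMap a s p) = S p.1 p.2 := by
    simp only [β, Sum.elim_comp_inr]
    by_cases hp : p ∈ Set.range π
    · obtain ⟨t, rfl⟩ := hp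
      exact eval_svMap_apply a πe xv t
    · rw [eval_svMap_of_not_mem_range a π xv hp]
      exact (hS p.1 p.2 fun h => hp (hπT _ h)).symm
  have hUV : eval β (uvMap n r s p) = R p.1 p.2 := by
    rw [eval_uvMap, ← hAB]
    rfl
  change eval β (uvMap n r s p + rename Sum.inr (svMap a s p)) = x p
  rw [eval_add, eval_rename, hSV, hUV, ← Matrix.add_apply, ← hx, matrixOfPt_apply]

/-- The number of variables: `|u| + |v| + |x| + |y| = 2rn + 2s`. [cite: KumarVolk2022, Lemma 3.2] -/
theorem card_vars (n r s : ℕ) :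
    Fintype.card (((Fin n × Fin r) ⊕ (Fin r × Fin n)) ⊕ (Fin s ⊕ Fin s)) = 2 * r * n + 2 * s := by
  simp only [Fintype.card_sum, Fintype.card_prod, Fintype.card_fin]
  ring

/-- Distinct nodes indexed by the `n²` positions, from `n²` distinct field elements
("`F` of size at least `n²`"). [cite: KumarVolk2022, Lemma 3.2] -/
def nodes {n : ℕ} (e : Fin (n ^ 2) ↪ F) : (Fin n × Fin n) ↪ F :=
  finProdFinEquiv.toEmbedding.trans ((finCongr (sq n).symm).toEmbedding.trans e)

/-- **Lemma 3.2, main case** (`r = 0` or `n ≥ 2`), in the fact's variables `Fin (2rn + 2s)`.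
[cite: KumarVolk2022, Lemma 3.2] -/
theorem lem_3_2_main {n : ℕ} (e : Fin (n ^ 2) ↪ F) {r s : ℕ} (hs : s ≤ n ^ 2)
    (h : r = 0 ∨ 2 ≤ n) :
    ∃ P : Fin n × Fin n → MvPolynomial (Fin (2 * r * n + 2 * s)) F,
      (∀ p, (P p).totalDegree ≤ n ^ 2) ∧ nonRigidSet F n r s ⊆ polyMapImage P := by
  let ev := Fintype.equivFinOfCardEq (card_vars n r s)
  refine ⟨fun p => rename ev (kvMap (nodes e) r s p), fun p => ?_, ?_⟩
  · exact (totalDegree_rename_le _ _).trans (totalDegree_kvMap_le _ r s p h)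
  · rw [polyMapImage_rename_equiv]
    exact nonRigidSet_subset_polyMapImage_kvMap _ hs

/-- **Lemma 3.2, the corner `n = r = 1`** (`s ≤ 1`): every `1 × 1` matrix is non-rigid and the
coordinate map `x_1` (degree `1 = n²`) covers it. [cite: KumarVolk2022, Lemma 3.2] -/
theorem lem_3_2_corner (s : ℕ) :
    ∃ P : Fin 1 × Fin 1 → MvPolynomial (Fin (2 * 1 * 1 + 2 * s)) F,
      (∀ p, (P p).totalDegree ≤ 1 ^ 2) ∧ nonRigidSet F 1 1 s ⊆ polyMapImage P := by
  refine ⟨fun _ => X ⟨0, by omega⟩, fun p => by simp, fun x _ => ⟨fun _ => x (0, 0), ?_⟩⟩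
  funext p
  change eval (fun _ => x (0, 0)) (X _) = x p
  rw [eval_X]
  congr 1
  exact Subsingleton.elim _ _

end Lemma32

/-! ### Theorem 1.1: the count -/

section Count

/-- Stars and bars, upper bound: `binom(K + M, K) ≤ (M + 1)^K` (used in place of print's
`binom(4εn² + n⁵, 4εn²) ≤ (2n⁵)^{4εn²}`). [cite: KumarVolk2022, Thm. 1.1 (proof)] -/
theorem choose_add_le_succ_pow (K M : ℕ) : (K + M).choose K ≤ (M + 1) ^ K := by
  induction K with
  | zero => simp
  | succ K ih =>
    have h := Nat.add_one_mul_choose_eq (K + M) K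
    have hKM : K + 1 + M = K + M + 1 := by omega
    rw [hKM, pow_succ]
    have key : (K + M + 1).choose (K + 1) * (K + 1) ≤ ((M + 1) ^ K * (M + 1)) * (K + 1) := by
      rw [← h]
      calc (K + M + 1) * (K + M).choose K
          ≤ ((M + 1) * (K + 1)) * (M + 1) ^ K := Nat.mul_le_mul (by nlinarith) ih
        _ = ((M + 1) ^ K * (M + 1)) * (K + 1) := by ring
    exact Nat.le_of_mul_le_mul_right key (Nat.succ_pos K)

/-- Lower bound: `(n + 1)^N ≤ binom(m + N, N)` whenever `n N ≤ m` (each factor `(m + i)/i` of the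
binomial is `≥ n + 1`; used in place of print's `binom(n² + n³, n²) ≥ n^{n²}`).
[cite: KumarVolk2022, Thm. 1.1 (proof)] -/
theorem succ_pow_le_choose (n : ℕ) : ∀ N m : ℕ, n * N ≤ m → (n + 1) ^ N ≤ (m + N).choose N := by
  intro N
  induction N with
  | zero => intro m _; simp
  | succ N ih =>
    intro m hm
    have h := Nat.add_one_mul_choose_eq (m + N) N
    have hmN : m + (N + 1) = m + N + 1 := by omega
    rw [hmN]
    have ih' := ih m ((Nat.mul_le_mul_left n (Nat.le_succ N)).trans hm)
    have key : (n + 1) ^ (N + 1) * (N + 1) ≤ (m + N + 1).choose (N + 1) * (N + 1) := by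
      rw [← h]
      calc (n + 1) ^ (N + 1) * (N + 1) = ((n + 1) * (N + 1)) * (n + 1) ^ N := by ring
        _ ≤ (m + N + 1) * (m + N).choose N := Nat.mul_le_mul (by nlinarith) ih'
    exact Nat.le_of_mul_le_mul_right key (Nat.succ_pos N)

/-- **The count of Theorem 1.1, for every `n ≥ 1`:** if `5K < n²` then
`binom(K + n²·n³, K) < binom(n·n + n³, n·n)` (so Lemma 2.1 applies with `N = D = n²`, `Δ = n³`).
[cite: KumarVolk2022, Thm. 1.1 (proof)] -/
theorem thm_1_1_count {n K : ℕ} (hn : 1 ≤ n) (hK : 5 * K < n ^ 2) :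
    (K + n ^ 2 * n ^ 3).choose K < (n * n + n ^ 3).choose (n * n) := by
  have h5 : n ^ 2 * n ^ 3 + 1 ≤ (n + 1) ^ 5 := by
    have : n ^ 5 < (n + 1) ^ 5 := Nat.pow_lt_pow_left (Nat.lt_succ_self n) (by norm_num)
    rw [← pow_add]
    exact this
  calc (K + n ^ 2 * n ^ 3).choose K ≤ (n ^ 2 * n ^ 3 + 1) ^ K := choose_add_le_succ_pow K _
    _ ≤ ((n + 1) ^ 5) ^ K := Nat.pow_le_pow_left h5 K
    _ = (n + 1) ^ (5 * K) := by rw [← pow_mul]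
    _ < (n + 1) ^ (n ^ 2) := Nat.pow_lt_pow_right (by omega) hK
    _ ≤ (n ^ 3 + n * n).choose (n * n) := by
        rw [sq]
        exact succ_pow_le_choose n (n * n) (n ^ 3) (le_of_eq (by ring))
    _ = (n * n + n ^ 3).choose (n * n) := by rw [Nat.add_comm]

/-- The arithmetic of "`r = εn` and `s = εn²` so `2rn + 2s = 4εn²`" with `ε < 1/25`, for natural
`r ≤ εn`, `s ≤ εn²` and `n ≥ 1`: `5·(2rn + 2s) < n²`, `r ≤ n`, `s ≤ n²`.
[cite: KumarVolk2022, Thm. 1.1 (proof)] -/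
theorem thm_1_1_params {ε : ℝ} (hε' : ε < 1 / 25) {n r s : ℕ} (hn : 1 ≤ n)
    (hr : (r : ℝ) ≤ ε * n) (hs : (s : ℝ) ≤ ε * (n : ℝ) ^ 2) :
    5 * (2 * r * n + 2 * s) < n ^ 2 ∧ r ≤ n ∧ s ≤ n ^ 2 := by
  have hn' : (1 : ℝ) ≤ n := by exact_mod_cast hn
  have hn0 : (0 : ℝ) ≤ n := by linarith
  have hrn : (r : ℝ) * n ≤ ε * n * n := mul_le_mul_of_nonneg_right hr hn0
  have hn2 : (0 : ℝ) < (n : ℝ) ^ 2 := by positivity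
  refine ⟨?_, ?_, ?_⟩
  · have h1 : ((5 * (2 * r * n + 2 * s) : ℕ) : ℝ) < ((n ^ 2 : ℕ) : ℝ) := by
      push_cast
      nlinarith
    exact_mod_cast h1
  · have : (r : ℝ) ≤ n := by nlinarith
    exact_mod_cast this
  · have : (s : ℝ) ≤ (n : ℝ) ^ 2 := by nlinarith
    exact_mod_cast this

end Count

end KumarVolk2020

/-- **Kumar–Volk, Lemma 2.1 — DISCHARGED** (`KumarVolk2020.exists_isEquationFor_polyMapImage` at
`ι = Fin N`, `κ = Fin K`). [cite: KumarVolk2022, Lemma 2.1] -/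
theorem kumarVolk2020_lem_2_1_holds : kumarVolk2020_lem_2_1 := by
  intro F _ K N D Δ P hP hlt
  refine KumarVolk2020.exists_isEquationFor_polyMapImage P hP ?_
  simpa only [Fintype.card_fin] using hlt

/-- **Kumar–Volk, Lemma 3.1 — DISCHARGED** (`KumarVolk2020.exists_svMap` with the nodes
`α_i := e(i)`, `i < n`, of the given embedding `e : Fin (n+1) ↪ F`; only `n` of the printed `n + 1`
field elements are used). [cite: KumarVolk2022, Lemma 3.1] -/
theorem kumarVolk2020_lem_3_1_holds : kumarVolk2020_lem_3_1 := by
  intro F _ n k hF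
  obtain ⟨e⟩ := hF
  have h := KumarVolk2020.exists_svMap (Fin.castSuccEmb.trans e) k
  simpa only [Fintype.card_fin] using h

/-- **Kumar–Volk, Lemma 3.2 — DISCHARGED** (`KumarVolk2020.lem_3_2_main`, and the corner
`n = r = 1` by `KumarVolk2020.lem_3_2_corner`). [cite: KumarVolk2022, Lemma 3.2] -/
theorem kumarVolk2020_lem_3_2_holds : kumarVolk2020_lem_3_2 := by
  intro F _ n r s hF hr hs
  obtain ⟨e⟩ := hF
  by_cases h : r = 0 ∨ 2 ≤ n
  · exact KumarVolk2020.lem_3_2_main e hs h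
  · obtain ⟨hr0, hn⟩ := not_or.1 h
    obtain rfl : n = 1 := by omega
    obtain rfl : r = 1 := by omega
    exact KumarVolk2020.lem_3_2_corner s

/-- **Kumar–Volk, Theorem 1.1 — DISCHARGED**, with threshold `n₀ = 1`: Lemma 3.2
(`kumarVolk2020_lem_3_2_holds`) + Lemma 2.1 (`KumarVolk2020.exists_isEquationFor_polyMapImage`
at `N = D = n²`, `Δ = n³`, `K = 2rn + 2s`) + the count `KumarVolk2020.thm_1_1_count`.
[cite: KumarVolk2022, Thm. 1.1] -/
theorem kumarVolk2020_thm_1_1_holds : kumarVolk2020_thm_1_1 := by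
  intro ε _ hε'
  refine ⟨1, fun n hn F _ hF r s hr hs => ?_⟩
  obtain ⟨hK, hrn, hsn⟩ := KumarVolk2020.thm_1_1_params hε' hn hr hs
  obtain ⟨P, hPdeg, hPim⟩ := kumarVolk2020_lem_3_2_holds F n r s hF hrn hsn
  obtain ⟨Q, hQ, hQdeg⟩ := KumarVolk2020.exists_isEquationFor_polyMapImage P
    (D := n ^ 2) (Δ := n ^ 3) hPdeg (by
      rw [Fintype.card_fin, Fintype.card_prod, Fintype.card_fin]
      exact KumarVolk2020.thm_1_1_count hn hK)
  exact ⟨Q, hQ.mono hPim, hQdeg⟩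

end Literature.Computability.AlgebraicComplexity

end
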